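import Literature.NumberTheory.EllipticCurves.BertoliniDarmonPrasanna2013.WaldspurgerCMSquareFormula
import Literature.NumberTheory.EllipticCurves.BDPCentralValueReciprocity
import Literature.NumberTheory.EllipticCurves.HeegnerPointsImaginaryQuadraticProofs
import Literature.NumberTheory.QuadraticFields.HeegnerCondition
import Literature.NumberTheory.GaloisRepresentations.HeckeCharacterAutConj
import Summits.BirchSwinnertonDyer.Rank1Residual.X11b.Three.ValueReciprocityDictionary
import Summits.BirchSwinnertonDyer.BirchSwinnertonDyer.Theorems.ClassRecordThreeUnramifiedFixedByOpen
import Summits.BirchSwinnertonDyer.BirchSwinnertonDyer.Theorems.ClassRecordThreeDefs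
import Summits.BirchSwinnertonDyer.BirchSwinnertonDyer.Theorems.ClassRecordThreeHsiehDescentSharpKernel
import HarnessLib

/-!
# Routes `ClassRecordThree` ∕ `KolyvaginRoadThree` — THE «HSIEH DOWN» KERNEL (planner g33 RULING 21 (A)): the crux
# `HsiehDescentAtThree` (item stmt-BirchSwinnertonDyer-19108) and its child `OpenValueReciprocityAtThree` (19281) as
# THESES-FREE theorems modulo BDP13's explicit Waldspurger formula in square-root shape (and, for 19108, Tate–Sen at 3)

Cell `bsd-stepL` (run/shared/lean/pub/bsd-stepL/), seat `bsd-stepL-desc3-p1x` (WIDTH-LEVER second prover lane on item 19281 ∕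
parent 19108, session g2), `--supports stmt-BirchSwinnertonDyer-19108`.

THE ASK (STATUS 2026-08-27T13:01:55Z RULING 21 (A), HOME/plan/HSIEHDOWN/README): ONE module with NO `Theses.*` file in its
import closure exporting

  `WaldspurgerKernel.hsiehDescentAt₃_of_thm54_of_tateSen
     (hX : BertoliniDarmonPrasanna2013.thm54_bdpLalg_eq_sq_sum_cmValues) (hTS : PAdicHodge.TateSenCharacterVanishing 3) :
     <the BODY of item 19108 `HsiehDescentAtThree`, verbatim>`

so that the planner can re-thread `closes` in BOTH @3 route files with `have h₃ : HsiehDescentAtThree := <this> hW hTS`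
(δ-unfolding; binders `hW : BDPWaldspurgerSquare := thm54_…` and `hTS : TateSenVanishingAtThree`, item 19238). The
mathematics is LANDED (ROAD W of this seat's g0 session + bdp g10's sharp reduction + lane A's glue) but every landed
module that states it imports a route file (`…OpenValueReciprocityOfWaldspurger` p531052 → `…OfBDP` → `…OfArchimedean` →
both Theses files; `…HsiehDescentSharp` → `Theses.ClassRecordThree`), so none of it is citable inside `closes`. This file
RE-HOMES the chain (the originals stay where they are; the gate's dedup rule forbids re-stating them as public theorems,
so the intermediate steps are `private` here and only NEW statements are exported):

* §1–§5 (private; = p531052 ll. 79–306, same statements, same proofs, namespace `WaldspurgerKernel`): Weil's conjugate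
  type is kept when `σ` fixes `K`; `σ(χ(𝔞)) = (^σχ)(𝔞)` on ideal values; `σ(√|d_K|) = √|d_K|` for `σ` fixing `K` and `i`;
  `σ(w(f,χ)) = w(f,^σχ)` (BDP Lemma 5.3 (3) as a theorem); the constants undone
  (`L/(π^{2n+1}Ω′^{4n}) = L_alg·w·4/(Γ(n)Γ(n+1)w_K√|d_K|2^{#S(f)})`, `Ω′ = Ω(√|d_K|/2)^{1/2}/π`); and
  **`thm54_bdpLalg_eq_sq_sum_cmValues → bertoliniDarmonPrasanna2013_centralValue_reciprocity`** (p419864's `Prop`).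
* §6 (private; = the Theses-free core of lane A's `…OfArchimedean` p420148): the `Aut(ℂ/F)`-reciprocity ⟹
  `∀ W, Theorems.ValueReciprocityBAtThree W` (T6-OPEN `UnramifiedOpen.exists_level_forall_fixing_rootsOfUnity_apply_symm_eq`
  + x11b3-p1's dictionary `Three.bdpInterpolationValue_exact_of_normalizedValue_exact`, `a_p ∈ ℤ`).
* §7 (exported): **`WaldspurgerKernel.hsiehDescentAt₃_of_thm54_of_tateSen`** (the planner's constant, binder order
  `(hX) (hTS)`) := §5 ∘ §6 ∘ `BdpSeat.Kernel.hsiehDescentAtThree_body_of_tateSenCharacter_of_valueReciprocityBAtThree`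
  (the Theses-free sharp descent, `Theorems/ClassRecordThreeHsiehDescentSharpKernel.lean`); the twin
  `WaldspurgerKernel.hsiehDescentAt₃_of_bdp2013_of_tateSen` for consumers of the assembled fact p419864; and
  `WaldspurgerKernel.openValueReciprocityAtThree_body_of_thm54` — the BODY of item 19281 verbatim from `thm54_…` alone.

HONEST FRAMING: CONDITIONAL results, re-homing only (0 defs, 0 new facts, 0 sorry). `thm54_bdpLalg_eq_sq_sum_cmValues`
(BDP13 Duke 162 Thm. 5.4 (5.1.12) ∕ (5.1.16) + Prop. 1.12 (1), reviewed p528626; ⟸ its two printed atoms by p536013) and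
`TateSenCharacterVanishing 3` (Brinon–Conrad Thm. 2.2.7) are PUBLISHED theorems carried as named facts, NOT discharged;
items 19108 ∕ 19281 are NOT closed by these theorems (conditional-result; the planner's DOWN makes them DERIVED in cone,
no label or count moves, T7); the node `Three.HsiehDescentAt₃` is untouched; BSD is not proved by any of this.

References: [BertoliniDarmonPrasanna2013] Prop. 1.12 (1), (4.1.3), Thm. 4.6, (5.1.6), Lemma 5.2, (5.1.11), Lemma 5.3,
Thm. 5.4 (5.1.12), (5.1.15), Thm. 5.5, (5.1.16); [Weil1956] §1; [BrinonConrad2009] Thm. 2.2.7; [Castella2018] Thm. 3.1;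
[SerreLocalFields1979] Ch. IV §4; tree originals p531052, p420148, p417285, p419864; cell files STATUS RULING 20 (B) ∕
RULING 21 (A), plan/HSIEHDOWN/README.md, TARGET §1.1 (R-b), PROOF-BDP §18/§27.
-/

noncomputable section

open scoped NumberField BigOperators
open NumberField IsDedekindDomain Field WeierstrassCurve
open Literature.NumberTheory.GaloisRepresentations
open Literature.NumberTheory.EllipticCurves
open Literature.NumberTheory.EllipticCurves.ModularForms
open Literature.NumberTheory.EllipticCurves.BertoliniDarmonPrasanna2013
open Summit.BirchSwinnertonDyer.Rank1Residual.X11b.Three (algEquiv_apply_heckeValueExtZero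
  bdpInterpolationValue_exact_of_normalizedValue_exact exists_int_cuspCoeff_eq_of_isNewformOf)

namespace Summit.BirchSwinnertonDyer.BirchSwinnertonDyer.Theorems

namespace WaldspurgerKernel

section Reciprocity

variable {K : Type} [Field K] [NumberField K]

/-! ### 1. The conjugate type `^σ(p,q)` is `(p,q)` when `σ` fixes every complex embedding of a
totally complex field -/

omit [NumberField K] in
/-- If `K` is totally complex and `σ ∈ Aut(ℂ)` fixes `e(K)` pointwise for every embedding
`e : K → ℂ`, then the conjugate infinity type `^σ(p, q)` is `(p, q)`. [folklore] -/
private theorem autConjType_eq_of_forall_apply_eq [IsTotallyComplex K] (σ : ℂ ≃ₐ[ℚ] ℂ)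
    (hσ : ∀ (e : K →+* ℂ) (k : K), σ (e k) = e k) (p q : InfinitePlace K → ℤ) :
    HeckeCharacter.autConjType σ p q = (p, q) := by
  have hcomp : ∀ e : K →+* ℂ,
      ((σ.symm : ℂ ≃ₐ[ℚ] ℂ).toAlgHom.toRingHom.comp e) = e := by
    intro e
    ext k
    change σ.symm (e k) = e k
    conv_lhs => rw [← hσ e k]
    exact σ.symm_apply_apply (e k)
  have hnr : ∀ w : InfinitePlace K, ¬ w.IsReal := fun w ↦
    InfinitePlace.not_isReal_iff_isComplex.mpr (IsTotallyComplex.isComplex w)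
  unfold HeckeCharacter.autConjType HeckeCharacter.typeOfExponent
  simp only [hcomp]
  refine Prod.ext ?_ ?_
  · funext w
    have h1 : ¬ ComplexEmbedding.IsReal w.embedding := fun h ↦ hnr w (InfinitePlace.isReal_iff.mpr h)
    simp only [HeckeCharacter.embExponent, h1, if_false, InfinitePlace.mk_embedding, if_true]
  · funext w
    have h1 : ¬ ComplexEmbedding.IsReal w.embedding := fun h ↦ hnr w (InfinitePlace.isReal_iff.mpr h)
    have h2 : ¬ ComplexEmbedding.IsReal (ComplexEmbedding.conjugate w.embedding) := fun h ↦
      h1 (ComplexEmbedding.isReal_conjugate_iff.mp h)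
    have h3 : ComplexEmbedding.conjugate w.embedding ≠
        (InfinitePlace.mk (ComplexEmbedding.conjugate w.embedding)).embedding := by
      rw [InfinitePlace.mk_conjugate_eq, InfinitePlace.mk_embedding]
      intro h
      exact h1 (ComplexEmbedding.isReal_iff.mpr h)
    simp only [HeckeCharacter.embExponent, hnr w, if_false, h2]
    rw [if_neg h3, InfinitePlace.mk_conjugate_eq, InfinitePlace.mk_embedding]

/-- For an imaginary quadratic `K` and `σ ∈ Aut(ℂ)` fixing both complex embeddings of `K`
pointwise, the conjugate `^σχ` of a Hecke character of type `(n, -n)` has type `(n, -n)` again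
(Weil 1956). [folklore] -/
private theorem hasInfinityType_autConj_of_forall_apply_eq [IsTotallyComplex K] {χ : HeckeCharacter K}
    {p q : InfinitePlace K → ℤ} (hχ : χ.HasInfinityType p q) (σ : ℂ ≃ₐ[ℚ] ℂ)
    (hσ : ∀ (e : K →+* ℂ) (k : K), σ (e k) = e k) :
    (hχ.autConj σ).HasInfinityType p q := by
  have h := hχ.hasInfinityType_autConj σ
  rw [autConjType_eq_of_forall_apply_eq σ hσ p q] at h
  exact h

/-! ### 2. `σ` on the ideal values `χ(𝔞)` -/

/-- `σ(χ(𝔞)) = (^σχ)(𝔞)` for the ideal values extended by zero (BDP (4.1.5)). [folklore] -/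
private theorem map_heckeIdealValueExtZero_autConj {χ : HeckeCharacter K} {p q : InfinitePlace K → ℤ}
    (hχ : χ.HasInfinityType p q) (σ : ℂ ≃ₐ[ℚ] ℂ) (𝔞 : Ideal (𝓞 K)) :
    σ (heckeIdealValueExtZero χ 𝔞) = heckeIdealValueExtZero (hχ.autConj σ) 𝔞 := by
  unfold heckeIdealValueExtZero
  rw [show (σ : ℂ → ℂ) = (σ : ℂ ≃* ℂ) from rfl, MulEquiv.map_finprod]
  refine finprod_congr fun v ↦ ?_
  rw [map_pow]
  change σ (heckeValueExtZero χ v) ^ _ = _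
  rw [algEquiv_apply_heckeValueExtZero hχ σ v]

/-- The ideal value `χ(𝔞)` of an everywhere unramified character at a non-zero ideal is non-zero
(a product of values at uniformizers, which are units). [folklore] -/
private theorem heckeIdealValueExtZero_ne_zero {χ : HeckeCharacter K}
    (hunr : ∀ v : HeightOneSpectrum (𝓞 K), χ.IsUnramifiedAt v) {𝔞 : Ideal (𝓞 K)} (h𝔞 : 𝔞 ≠ ⊥) :
    heckeIdealValueExtZero χ 𝔞 ≠ 0 := by
  have hfin := Ideal.finite_factors h𝔞
  rw [heckeIdealValueExtZero_eq_prod χ h𝔞 hfin.toFinset (fun v hv ↦ hfin.mem_toFinset.mpr hv)]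
  refine Finset.prod_ne_zero_iff.mpr fun v _ ↦ pow_ne_zero _ ?_
  rw [heckeValueExtZero_of_isUnramifiedAt (hunr v), HeckeCharacter.valueAtUniformizer]
  exact Units.ne_zero _

/-! ### 3. `σ` fixes `√|d_K|` when it fixes `K` and `i` -/

/-- For an imaginary quadratic `K`: if `σ ∈ Aut(ℂ)` fixes every `e(K)` pointwise and fixes `i`,
then `σ(√|d_K|) = √|d_K|` — indeed `√|d_K| = ∓ i · e(√d_K)` with `√d_K ∈ K`. [folklore] -/
private theorem map_sqrt_abs_discr (hK : IsImaginaryQuadratic K) (σ : ℂ ≃ₐ[ℚ] ℂ)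
    (hσ : ∀ (e : K →+* ℂ) (k : K), σ (e k) = e k) (hI : σ Complex.I = Complex.I) :
    σ (Real.sqrt |(NumberField.discr K : ℝ)| : ℂ) = (Real.sqrt |(NumberField.discr K : ℝ)| : ℂ) := by
  obtain ⟨-, -, δ, -, hδ⟩ :=
    Literature.NumberTheory.QuadraticFields.Quadratic.exists_sq_eq_discr (K := K) hK.1
  have hneg : (NumberField.discr K : ℝ) < 0 := by exact_mod_cast hK.discr_neg
  set s : ℝ := Real.sqrt |(NumberField.discr K : ℝ)| with hs
  have hs2 : (s : ℂ) ^ 2 = -(NumberField.discr K : ℂ) := by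
    rw [← Complex.ofReal_pow, hs, Real.sq_sqrt (abs_nonneg _), abs_of_neg hneg]
    push_cast
    ring
  -- an embedding of `K`
  obtain ⟨w⟩ := (inferInstance : Nonempty (InfinitePlace K))
  set e : K →+* ℂ := w.embedding
  set z : ℂ := e (δ : K) with hz
  have hδK : ((δ : K)) ^ 2 = (NumberField.discr K : K) := by
    have h := congrArg (fun x : 𝓞 K ↦ (x : K)) hδ
    simpa using h
  have hz2 : z ^ 2 = (NumberField.discr K : ℂ) := by
    rw [hz, ← map_pow, hδK, map_intCast]
  have hsq : (Complex.I * (s : ℂ)) ^ 2 = z ^ 2 := by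
    rw [mul_pow, Complex.I_sq, hs2, hz2]; ring
  have hσz : σ z = z := hσ e _
  rcases eq_or_eq_neg_of_sq_eq_sq _ _ hsq with h | h
  · -- `i s = z`
    have : (s : ℂ) = -Complex.I * z := by
      rw [← h]; ring_nf; rw [Complex.I_sq]; ring
    rw [this, map_mul, map_neg, hI, hσz]
  · have : (s : ℂ) = Complex.I * z := by
      have h' : Complex.I * (s : ℂ) = -z := h
      calc (s : ℂ) = -Complex.I * (Complex.I * (s : ℂ)) := by
            ring_nf; rw [Complex.I_sq]; ring
        _ = Complex.I * z := by rw [h']; ring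
    rw [this, map_mul, hI, hσz]

/-! ### 4. Undoing BDP's constants -/

/-- `σ(w(f,χ)) = w(f,^σχ)` for `σ` fixing `w_f` and `b_N` (BDP Lemma 5.3 (3) at `k = 2`, `ε_f = 𝟙`,
from the explicit formula (5.1.11)). [folklore] -/
private theorem map_bdpConstW_autConj {χ : HeckeCharacter K} {p q : InfinitePlace K → ℤ}
    (hχ : χ.HasInfinityType p q) (σ : ℂ ≃ₐ[ℚ] ℂ) {wf bN : ℂ} (hwf : σ wf = wf) (hbN : σ bN = bN)
    (𝔟 : Ideal (𝓞 K)) (N₀ n : ℕ) :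
    σ (bdpConstW wf χ 𝔟 N₀ bN n) = bdpConstW wf (hχ.autConj σ) 𝔟 N₀ bN n := by
  unfold bdpConstW
  simp only [map_mul, map_pow, map_zpow₀, map_neg, map_natCast, hwf, hbN,
    map_heckeIdealValueExtZero_autConj hχ σ]

/-- **The constants undone.** With `Ω' := Ω·(√|d_K|/2)^{1/2}/π` (so `Ω'^4 = Ω^4·|d_K|/(4π^4)`):
`L(f/K,φ,1)/(π^{2n+1}Ω'^{4n}) = L_alg · w(f,χ) · 4/(Γ(n)Γ(n+1)·w_K·√|d_K|·2^{#S(f)})` — pure algebra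
on BDP's `C(f,χ,1) = ¼π^{2n−1}Γ(n)Γ(n+1)w_K√|d_K|(√|d_K|/2)^{−2n}2^{#S(f)}` (Thm. 4.6) and
`L_alg = w⁻¹·C·L/Ω^{4n}` (Thm. 5.5). [folklore] -/
private theorem rankinSelberg_div_eq_bdpLalg_mul {N : ℕ} (f : CuspForm (CongruenceSubgroup.Gamma0 N) 2)
    (sf : ℕ) {wf bN Ω : ℂ} (𝔟 : Ideal (𝓞 K)) (N₀ : ℕ) (hΩ : Ω ≠ 0)
    (hd : NumberField.discr K ≠ 0) {φ : HeckeCharacter K} {n : ℕ} (hn : 0 < n)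
    (hW : bdpConstW wf φ 𝔟 N₀ bN n ≠ 0) :
    rankinSelbergValueHecke f φ 1 /
        ((Real.pi : ℂ) ^ (2 * n + 1) *
          (Ω * (Real.sqrt (Real.sqrt |(NumberField.discr K : ℝ)| / 2) : ℂ) / (Real.pi : ℂ)) ^ (4 * n)) =
      bdpLalg f sf wf 𝔟 N₀ bN Ω φ n * bdpConstW wf φ 𝔟 N₀ bN n *
        (4 / (Complex.Gamma n * Complex.Gamma (n + 1) * (Units.torsionOrder K : ℂ) *
          (Real.sqrt |(NumberField.discr K : ℝ)| : ℂ) * 2 ^ sf)) := by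
  obtain ⟨m, rfl⟩ : ∃ m, n = m + 1 := ⟨n - 1, by omega⟩
  set s : ℝ := Real.sqrt |(NumberField.discr K : ℝ)| with hs
  have hs0 : 0 < s := Real.sqrt_pos.mpr (abs_pos.mpr (by exact_mod_cast hd))
  set r : ℝ := Real.sqrt (s / 2) with hr
  have hr0 : 0 < r := Real.sqrt_pos.mpr (by positivity)
  have hr2 : (r : ℂ) ^ 2 = (s : ℂ) / 2 := by
    rw [← Complex.ofReal_pow, hr, Real.sq_sqrt (by positivity)]
    push_cast
    ring
  have hr4 : (r : ℂ) ^ (4 * (m + 1)) = ((s : ℂ) / 2) ^ (2 * (m + 1)) := by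
    rw [show 4 * (m + 1) = 2 * (2 * (m + 1)) by ring, pow_mul, hr2]
  have hsC : (s : ℂ) ≠ 0 := Complex.ofReal_ne_zero.mpr hs0.ne'
  have hrC : (r : ℂ) ≠ 0 := Complex.ofReal_ne_zero.mpr hr0.ne'
  have hπ : (Real.pi : ℂ) ≠ 0 := Complex.ofReal_ne_zero.mpr Real.pi_ne_zero
  have hΓ1 : Complex.Gamma ((m + 1 : ℕ) : ℂ) ≠ 0 := by
    rw [Nat.cast_succ, Complex.Gamma_nat_eq_factorial]
    exact_mod_cast Nat.factorial_ne_zero m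
  have hΓ2 : Complex.Gamma (((m + 1 : ℕ) : ℂ) + 1) ≠ 0 := by
    rw [Complex.Gamma_nat_eq_factorial]
    exact_mod_cast Nat.factorial_ne_zero (m + 1)
  have hwK : (Units.torsionOrder K : ℂ) ≠ 0 := by exact_mod_cast (Units.torsionOrder_pos K).ne'
  have hzp : ((s : ℂ) / 2) ^ (-(2 * ((m + 1 : ℕ) : ℤ))) = (((s : ℂ) / 2) ^ (2 * (m + 1)))⁻¹ := by
    rw [zpow_neg, show (2 * ((m + 1 : ℕ) : ℤ)) = ((2 * (m + 1) : ℕ) : ℤ) by push_cast; ring,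
      zpow_natCast]
  unfold bdpLalg bdpConstC
  rw [hzp, show 2 * (m + 1) - 1 = 2 * m + 1 by omega, div_pow, mul_pow, hr4]
  field_simp
  ring

/-! ### 5. The reciprocity law from the square-root formula -/

/-- **BDP13's `Aut(ℂ/H(i))`-reciprocity of `L(f/K,χ,1)/(π^{2n+1}Ω^{4n})` (the tree's named fact
`bertoliniDarmonPrasanna2013_centralValue_reciprocity`, p419864) FOLLOWS from the explicit Waldspurger
formula in square-root form (BDP13 Thm. 5.4 / (5.1.16) + Prop. 1.12 (1)).** Proof = the Galois
bookkeeping (D4)–(D5) of that fact's docstring, now in the kernel: apply `σ` to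
`L_alg(χ) = (∑ χ_j(𝔞)⁻¹ V_𝔞)²`, move `σ` inside (`σ V_𝔞 = V_𝔞`, `σ(χ_j(𝔞)) = (^σχ)_j(𝔞)` by Weil), recognise
`L_alg(^σχ)` (the formula at `^σχ`, of the same type since `σ` fixes `K`), and undo the constants `w(f,χ)`
(`σ w(f,χ) = w(f,^σχ)`) and `C(f,χ,1)` (`σ √|d_K| = √|d_K|` as `σ i = i`), with the period
`Ω' = Ω·(√|d_K|/2)^{1/2}/π`. [cite: BertoliniDarmonPrasanna2013, Thm. 5.4 (5.1.12), (5.1.16), Thm. 5.5 (pp. 59–60)] -/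
private theorem bdp2013_centralValue_reciprocity_of_waldspurgerSq (hX : thm54_bdpLalg_eq_sq_sum_cmValues) :
    bertoliniDarmonPrasanna2013_centralValue_reciprocity := by
  intro W _ K _ _ N _ f hnf hN hK hodd hHeeg
  obtain ⟨Ω, wf, bN, 𝔟, sf, F, hΩ, hwf, hbN, h𝔟, hFfin, hKF, hIF, hwfF, hbNF, hram, hsq⟩ :=
    hX W K f hnf hN hK hodd hHeeg
  haveI : IsTotallyComplex K := hK.2
  have hd : NumberField.discr K ≠ 0 := hK.discr_neg.ne
  -- the rescaled period
  set r : ℝ := Real.sqrt (Real.sqrt |(NumberField.discr K : ℝ)| / 2) with hr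
  have hr0 : 0 < r :=
    Real.sqrt_pos.mpr (by
      have : 0 < Real.sqrt |(NumberField.discr K : ℝ)| :=
        Real.sqrt_pos.mpr (abs_pos.mpr (by exact_mod_cast hd))
      positivity)
  have hπ : (Real.pi : ℂ) ≠ 0 := Complex.ofReal_ne_zero.mpr Real.pi_ne_zero
  have hΩ' : Ω * (r : ℂ) / (Real.pi : ℂ) ≠ 0 :=
    div_ne_zero (mul_ne_zero hΩ (Complex.ofReal_ne_zero.mpr hr0.ne')) hπ
  refine ⟨Ω * (r : ℂ) / (Real.pi : ℂ), F, hΩ', hFfin, hKF, hram, ?_⟩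
  intro σ hσ χ n hn hunr hχ
  obtain ⟨A, V, hV, hform⟩ := hsq n hn
  have hσK : ∀ (e : K →+* ℂ) (k : K), σ (e k) = e k := fun e k ↦ hσ _ (hKF e k)
  have hσI : σ Complex.I = Complex.I := hσ _ hIF
  -- the conjugate character is again in the range of the formula
  have hχσ_type : (hχ.autConj σ).HasInfinityType (fun _ ↦ (n : ℤ)) (fun _ ↦ -(n : ℤ)) :=
    hasInfinityType_autConj_of_forall_apply_eq hχ σ hσK
  have hχσ_unr : ∀ v : HeightOneSpectrum (𝓞 K), (hχ.autConj σ).IsUnramifiedAt v := fun v ↦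
    (hχ.isUnramifiedAt_autConj_iff σ v).mpr (hunr v)
  have h1 := hform χ hunr hχ
  have h2 := hform (hχ.autConj σ) hχσ_unr hχσ_type
  -- non-vanishing of `w(f,χ)` and `w(f,^σχ)`
  have hN0 : (N : ℂ) ≠ 0 := by exact_mod_cast (NeZero.ne N)
  have hWne : ∀ {ψ : HeckeCharacter K}, (∀ v : HeightOneSpectrum (𝓞 K), ψ.IsUnramifiedAt v) →
      bdpConstW wf ψ 𝔟 N bN n ≠ 0 := by
    intro ψ hψ
    unfold bdpConstW
    refine mul_ne_zero (mul_ne_zero (mul_ne_zero hwf (mul_ne_zero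
      (heckeIdealValueExtZero_ne_zero hψ h𝔟) (pow_ne_zero _ ?_))) (pow_ne_zero _ (neg_ne_zero.mpr hN0)))
      (zpow_ne_zero _ hbN)
    exact_mod_cast (Ideal.absNorm_eq_zero_iff.not.mpr h𝔟)
  rw [rankinSelberg_div_eq_bdpLalg_mul f sf 𝔟 N hΩ hd hn (hWne hunr),
    rankinSelberg_div_eq_bdpLalg_mul f sf 𝔟 N hΩ hd hn (hWne hχσ_unr), h1, h2, map_mul, map_mul,
    map_bdpConstW_autConj hχ σ (hσ _ hwfF) (hσ _ hbNF)]
  -- the rational constant `4/(Γ(n)Γ(n+1) w_K √|d_K| 2^{#S(f)})` is fixed by `σ`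
  have hconst : σ (4 / (Complex.Gamma n * Complex.Gamma (n + 1) * (Units.torsionOrder K : ℂ) *
      (Real.sqrt |(NumberField.discr K : ℝ)| : ℂ) * 2 ^ sf)) =
      4 / (Complex.Gamma n * Complex.Gamma (n + 1) * (Units.torsionOrder K : ℂ) *
        (Real.sqrt |(NumberField.discr K : ℝ)| : ℂ) * 2 ^ sf) := by
    obtain ⟨m, rfl⟩ : ∃ m, n = m + 1 := ⟨n - 1, by omega⟩
    have hG1 : Complex.Gamma ((m + 1 : ℕ) : ℂ) = (m.factorial : ℂ) := by
      rw [Nat.cast_succ, Complex.Gamma_nat_eq_factorial]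
    have hG2 : Complex.Gamma (((m + 1 : ℕ) : ℂ) + 1) = ((m + 1).factorial : ℂ) := by
      rw [Complex.Gamma_nat_eq_factorial]
    rw [hG1, hG2]
    simp only [map_div₀, map_mul, map_pow, map_natCast, map_ofNat, map_sqrt_abs_discr hK σ hσK hσI]
  rw [hconst, map_pow, map_sum]
  congr 3
  refine Finset.sum_congr rfl fun 𝔞 h𝔞 ↦ ?_
  rw [map_mul, map_inv₀, map_mul, map_pow, map_natCast, map_heckeIdealValueExtZero_autConj hχ σ,
    hσ _ (hV 𝔞 h𝔞)]

end Reciprocity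

/-! ### 6. The `Aut(ℂ/F)`-reciprocity gives the sharp clause `ValueReciprocityBAtThree` at every curve -/

/-- (private re-homing of the Theses-free core of lane A's `openValueReciprocityAtThree_of_archimedeanReciprocity`,
p420148) **`bertoliniDarmonPrasanna2013_centralValue_reciprocity → ∀ W, Theorems.ValueReciprocityBAtThree W`.** Proof:
the fact's ramification clause at `ℓ = 3` (odd, split in `K`); T6-OPEN
(`UnramifiedOpen.exists_level_forall_fixing_rootsOfUnity_apply_symm_eq`) gives `m`, `3 ∤ m`, with every `τ` fixing `μ_m`
fixing `ι′⁻¹(F)`, so `σ = ι′τι′⁻¹` fixes `F`; x11b3-p1's dictionary `Three.bdpInterpolationValue_exact_of_normalizedValue_exact`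
(`a_p ∈ ℤ` by `IsNewformOf`) transports exactness to `bdpInterpolationValue`. Conditional glue; nothing discharged.
[cite: BertoliniDarmonPrasanna2013, Thm. 5.5 and (5.1.16) (p. 60)] [cite: Castella2018, Thm. 3.1 (arXiv:1704.06608 p. 9)]
[cite: SerreLocalFields1979, Ch. IV §4 Prop. 16 and Cor. 1] -/
private theorem valueReciprocityBAtThree_of_bdp2013 (hArch : bertoliniDarmonPrasanna2013_centralValue_reciprocity) :
    ∀ (W : WeierstrassCurve ℚ) [W.IsElliptic] [W.IsGloballyMinimal], ValueReciprocityBAtThree W := by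
  intro W _ _ ι' K _ _ 𝔭 κ N _ f hf _ _ hN hKiq hodd hHeeg hsplit _ _ _ _ _ _
  haveI : Fact (Nat.Prime 3) := ⟨Nat.prime_three⟩
  obtain ⟨Ω, F, hΩ, hFd, -, hunrF, hexact⟩ := hArch W K f hf hN hKiq hodd hHeeg
  have hunr3 : ∀ P : Ideal (𝓞 F), P.IsPrime → ((3 : ℕ) : 𝓞 F) ∈ P → P.ramificationIdx (𝓞 ℚ) = 1 :=
    hunrF 3 Nat.prime_three (by decide) hsplit
  obtain ⟨m, hm, h3m, hfix⟩ :=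
    UnramifiedOpen.exists_level_forall_fixing_rootsOfUnity_apply_symm_eq 3 ι' F hFd hunr3
  refine ⟨Ω, hΩ, m, hm, h3m, fun τ σ hτ hστ χ n hn hunrχ hχ _ _ _ ↦ ?_⟩
  have hσF : ∀ x : ℂ, x ∈ F → σ x = x := fun x hx ↦ by
    have h := hστ (ι'.symm x)
    rwa [ι'.apply_symm_apply, hfix τ hτ x hx, ι'.apply_symm_apply] at h
  exact bdpInterpolationValue_exact_of_normalizedValue_exact 3 (exists_int_cuspCoeff_eq_of_isNewformOf hf 3) 𝔭 hχ
    n Ω σ (hexact σ hσF χ n hn hunrχ hχ)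

/-! ### 7. The exported kernels -/

/-- **THE «HSIEH DOWN» KERNEL (planner g33 RULING 21 (A)): the BODY of item stmt-BirchSwinnertonDyer-19108
`HsiehDescentAtThree` (both @3 route files, VERBATIM) from exactly TWO refereed facts BY NAME — BDP13's explicit
Waldspurger formula in square-root shape `thm54_bdpLalg_eq_sq_sum_cmValues` (Duke 162 Thm. 5.4 (5.1.12) ∕ (5.1.16) +
Prop. 1.12 (1)) and the printed Tate–Sen theorem at `3` (`TateSenCharacterVanishing 3`, Brinon–Conrad Thm. 2.2.7).**
Proof: §5 (the `Aut(ℂ/H(i))`-reciprocity of `L(f/K,χ,1)/(π^{2n+1}Ω^{4n})`) ∘ §6 (`∀ W, ValueReciprocityBAtThree W`) ∘ the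
Theses-free sharp descent `BdpSeat.Kernel.hsiehDescentAtThree_body_of_tateSenCharacter_of_valueReciprocityBAtThree`. This
module imports no `Theses.*` file, so `have h₃ : HsiehDescentAtThree := WaldspurgerKernel.hsiehDescentAt₃_of_thm54_of_tateSen hW hTS`
elaborates inside either route file (δ-unfolding). CONDITIONAL on both named facts (NOT discharged); item 19108 is NOT
closed by this theorem (conditional-result). [cite: BertoliniDarmonPrasanna2013, Thm. 5.4 (5.1.12) and (5.1.16) (pp. 59–60)]
[cite: BrinonConrad2009, Thm. 2.2.7] -/
theorem hsiehDescentAt₃_of_thm54_of_tateSen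
    (hX : Literature.NumberTheory.EllipticCurves.BertoliniDarmonPrasanna2013.thm54_bdpLalg_eq_sq_sum_cmValues)
    (hTS : Literature.NumberTheory.PAdicHodge.TateSenCharacterVanishing 3) :
    ∀ (W : WeierstrassCurve ℚ) [W.IsElliptic] [W.IsGloballyMinimal], Summit.BirchSwinnertonDyer.Rank1Residual.ClassX11b W 3 → (Literature.NumberTheory.EllipticCurves.Rank1Residual.Ram W 3 → W.HasSplitMultiplicativeReductionAtPrime 3 → Summit.BirchSwinnertonDyer.Rank1Residual.X11b.Three.HsiehDescentAt₃ W) ∧ (¬ Literature.NumberTheory.EllipticCurves.Rank1Residual.Ram W 3 → Literature.NumberTheory.EllipticCurves.Rank1Residual.Surj W 3 → Summit.BirchSwinnertonDyer.Rank1Residual.X11b.Three.HsiehDescentAt₃ W) :=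
  Summit.BirchSwinnertonDyer.Rank1Residual.X11b.Three.BdpSeat.Kernel.hsiehDescentAtThree_body_of_tateSenCharacter_of_valueReciprocityBAtThree
    hTS
    (valueReciprocityBAtThree_of_bdp2013 (bdp2013_centralValue_reciprocity_of_waldspurgerSq hX))

/-- **Twin for the consumers of the assembled fact p419864: the BODY of item 19108 (verbatim) from
`bertoliniDarmonPrasanna2013_centralValue_reciprocity` (BDP13 Thm. 5.5 ∕ (5.1.16) ∕ Prop. 1.12 (1) ∕ Lemma 5.3 (3), the
`Aut(ℂ/F)`-reciprocity as ONE print-derived named fact) and `TateSenCharacterVanishing 3`** — Theses-free version of lane A's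
`classRecordThree_hsiehDescentAtThree_of_tateSen_of_bdp2013` (`…OpenValueReciprocityOfBDP`, which imports both route files).
CONDITIONAL on both; item 19108 is NOT closed by this theorem.
[cite: BertoliniDarmonPrasanna2013, Thm. 5.5 and (5.1.16) (p. 60)] [cite: BrinonConrad2009, Thm. 2.2.7] -/
theorem hsiehDescentAt₃_of_bdp2013_of_tateSen
    (hBDP : Literature.NumberTheory.EllipticCurves.bertoliniDarmonPrasanna2013_centralValue_reciprocity)
    (hTS : Literature.NumberTheory.PAdicHodge.TateSenCharacterVanishing 3) :
    ∀ (W : WeierstrassCurve ℚ) [W.IsElliptic] [W.IsGloballyMinimal], Summit.BirchSwinnertonDyer.Rank1Residual.ClassX11b W 3 → (Literature.NumberTheory.EllipticCurves.Rank1Residual.Ram W 3 → W.HasSplitMultiplicativeReductionAtPrime 3 → Summit.BirchSwinnertonDyer.Rank1Residual.X11b.Three.HsiehDescentAt₃ W) ∧ (¬ Literature.NumberTheory.EllipticCurves.Rank1Residual.Ram W 3 → Literature.NumberTheory.EllipticCurves.Rank1Residual.Surj W 3 → Summit.BirchSwinnertonDyer.Rank1Residual.X11b.Three.HsiehDescentAt₃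 W) :=
  Summit.BirchSwinnertonDyer.Rank1Residual.X11b.Three.BdpSeat.Kernel.hsiehDescentAtThree_body_of_tateSenCharacter_of_valueReciprocityBAtThree
    hTS
    (valueReciprocityBAtThree_of_bdp2013 hBDP)

/-- **The BODY of item stmt-BirchSwinnertonDyer-19281 `OpenValueReciprocityAtThree` (SHARP K5-B; both @3 route files,
VERBATIM = `∀ W, Theorems.ValueReciprocityBAtThree W` unfolded) from `thm54_bdpLalg_eq_sq_sum_cmValues` ALONE** — Theses-free
version of this seat's `openValueReciprocityAtThree_of_waldspurgerSq` (p531052 §6). CONDITIONAL on the named fact; item 19281 is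
NOT closed by this theorem. [cite: BertoliniDarmonPrasanna2013, Thm. 5.4 (5.1.12) and (5.1.16) (pp. 59–60)] -/
theorem openValueReciprocityAtThree_body_of_thm54
    (hX : Literature.NumberTheory.EllipticCurves.BertoliniDarmonPrasanna2013.thm54_bdpLalg_eq_sq_sum_cmValues) :
    ∀ (W : WeierstrassCurve ℚ) [W.IsElliptic] [W.IsGloballyMinimal], ∀ (ι' : PadicAlgCl 3 ≃+* ℂ) (K : Type) [Field K] [NumberField K] (𝔭 : IsDedekindDomain.HeightOneSpectrum (NumberField.RingOfIntegers K)) (κ : Literature.NumberTheory.EllipticCurves.ZpExtension K 3) {N : ℕ} [NeZero N] (f : CuspForm (CongruenceSubgroup.Gamma0 N) 2), Literature.NumberTheory.EllipticCurves.ModularForms.IsNewformOf W f → Summit.BirchSwinnertonDyer.Rank1Residual.ClassX11b W 3 → Literature.NumberTheory.EllipticCurves.Rank1Residual.Surj W 3 → W.conductorNorm ℤ = N → Literature.NumberTheory.EllipticCurves.IsImaginaryQuadratic K → Odd (NumberField.discr K) → Literature.NumberTheory.EllipticCurves.SatisfiesHeegnerHypothesis N K → ((Ideal.span {(3 : ℤ)}).primesOver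 (NumberField.RingOfIntegers K)).ncard = 2 → ((3 : ℕ) : NumberField.RingOfIntegers K) ∈ 𝔭.asIdeal → 𝔭.asIdeal.ramificationIdx (NumberField.RingOfIntegers ℚ) = 1 → 𝔭.asIdeal.inertiaDeg (NumberField.RingOfIntegers ℚ) = 1 → (∀ (w : NumberField.InfinitePlace K) (k : NumberField.RingOfIntegers K), k ∈ 𝔭.asIdeal ↔ ‖ι'.symm (w.embedding (k : K))‖ < 1) → (∀ ℓ : ℕ, ℓ.Prime → ℓ ∣ N → ∃ v : IsDedekindDomain.HeightOneSpectrum (NumberField.RingOfIntegers K), Ideal.absNorm v.asIdeal = ℓ) → κ.IsAnticyclotomic → ∃ Ω : ℂ, Ω ≠ 0 ∧ ∃ m : ℕ, 0 < m ∧ ¬ 3 ∣ m ∧ (∀ (τ : PadicAlgCl 3 ≃ₐ[ℚ_[3]] PadicAlgCl 3) (σ : ℂ ≃ₐ[ℚ] ℂ), (∀ ζ : PadicAlgCl 3, ζ ^ m = 1 → τ ζ = ζ) → (∀ z : PadicAlgCl 3, σ (ι' z) = ι' (τ z)) → ∀ (χ : Literature.NumberTheory.GaloisRepresentations.HeckeCharacter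 K) (n : ℕ), 0 < n → (∀ v : IsDedekindDomain.HeightOneSpectrum (NumberField.RingOfIntegers K), χ.IsUnramifiedAt v) → ∀ hχ : χ.HasInfinityType (fun _ ↦ (n : ℤ)) (fun _ ↦ -(n : ℤ)), ∀ r : Literature.NumberTheory.GaloisRepresentations.FramedGaloisRep K (PadicAlgCl 3) 1, Literature.NumberTheory.EllipticCurves.IsPAdicAvatarOf ι' χ r → Literature.NumberTheory.EllipticCurves.FactorsThroughZp κ r → σ (Literature.NumberTheory.EllipticCurves.bdpInterpolationValue 3 f 𝔭 χ n Ω) = Literature.NumberTheory.EllipticCurves.bdpInterpolationValue 3 f 𝔭 (hχ.autConj σ) n Ω) :=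
  fun W _ _ ↦ valueReciprocityBAtThree_of_bdp2013 (bdp2013_centralValue_reciprocity_of_waldspurgerSq hX) W

end WaldspurgerKernel

end Summit.BirchSwinnertonDyer.BirchSwinnertonDyer.Theorems

end
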